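import Summits.Ventures.CertifiedManyBodySolver.Theorems.TcThermcert1FreeCanonicalCombesThomasToolkit
import Summits.Ventures.CertifiedManyBodySolver.Theorems.TcThermcert1FreeCanonicalExpPerturbation
import Summits.Ventures.CertifiedManyBodySolver.Theorems.TcThermcert1FreeCanonicalGoodArcGap
import Literature.Geometry.Lorentzian.ConstraintFamilies
import HarnessLib

/-!
# Free canonical gas at `β·t = 8` — Combes–Thomas perturbation estimates for stub S4 (generic finite-dimensional part)

Helper file for route `TcThermcert1` (crux K1′ `ThermalStiffnessCeilingU8b8_le_7o44`, item `stmt-Ventures-24560`), crux idea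
`free-canonical-b8-rung` (sketch `Cruxes/ThermalStiffnessCeilingU8b10_le_1o8/FreeCanonicalB8Sketch.lean`, stub S4
`stub_arcPropagator_decay`; memo `Cruxes/…/FreeCanonicalB8-leafhand-g0.md` §2). Continuation of
`Theorems/TcThermcert1FreeCanonicalCombesThomasToolkit.lean` / `…ExpPerturbation.lean` / `…GoodArcGap.lean`; consumed by
`Theorems/TcThermcert1FreeCanonicalArcKernelDecay.lean` (S4 on the torus).

Combes–Thomas BY CONJUGATION needs three volume-independent estimates, all proved here for an arbitrary finite index type:
* §1 for a weight `w` with `|w(x) − w(y)| ≤ μ` across every non-zero entry of `M`, the conjugate `ρ_w M ρ_w⁻¹` (`ρ_w = diag(e^w)`) differs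
  from `M` entrywise by a factor at most `e^μ − 1` (so row sums scale by `e^μ − 1`; the scalar inequality `|e^t − 1| ≤ e^{|t|} − 1` is the
  tree's `Literature.Geometry.Lorentzian.Deformation.abs_exp_sub_one_le_exp_abs_sub_one`); `ρ_w⁻¹ = ρ_{−w}`, `ρ_w` is a unit;
* §2 in the `ℓ∞`-operator (max-row-sum) Banach algebra (`open scoped Matrix.Norms.Operator`), `ρ_w e^{cM} ρ_w⁻¹ = e^{cρ_wMρ_w⁻¹}`
  (`Matrix.exp_conj`) and the tree's `norm_exp_sub_exp_le` bound every ROW sum of `ρ_w e^{cM} ρ_w⁻¹ − e^{cM}` by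
  `‖c‖(e^μ − 1)m·e^{‖c‖e^μ m}` (`m` = row-sum bound of `M`); for symmetric `M` the same bound holds for COLUMN sums (weight `−w`);
* §3 Euclidean lower bounds `c‖v‖² ≤ ‖Av‖²` (the currency of the tree's `goodArc_resolvent_gap`): they survive a perturbation `B` with
  `‖Bv‖² ≤ (c/16)‖v‖²` at the price `c ↦ c/4` (square-root-free: `0 ≤ ‖Av/2 + Bv‖²`), they give invertibility, and they bound every
  entry of the inverse, `|(A⁻¹)_{ij}|² ≤ 1/c`.

HONEST LABEL: finite-dimensional linear algebra; a step of a RUNG (`U = 0`, BC5-type witness for the C8 bet), reach at `U = 8` ZERO; decides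
nothing about K1/K1′/`T_c`; superconductivity in the Hubbard model is NOT proved or advanced by this file beyond the rung.
-/

noncomputable section

namespace Summit.Ventures.CertifiedManyBodySolver.Theorems.TcThermcert1.FreeCanonicalB8

open NormedSpace Matrix Finset
open Literature.MathematicalPhysics.QuantumLattice
open scoped ComplexOrder ComplexConjugate

/-! ## §1 Conjugation by a Lipschitz exponential weight moves the entries by a factor `e^μ − 1` -/

section Generic

variable {ι : Type*} [Fintype ι] [DecidableEq ι]

/-- `diag(e^w) · diag(e^{−w}) = 1`. -/
theorem diagonal_exp_mul_diagonal_exp_neg (w : ι → ℝ) :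
    diagonal (fun i => ((Real.exp (w i) : ℝ) : ℂ)) * diagonal (fun i => ((Real.exp (-w i) : ℝ) : ℂ)) = 1 := by
  rw [diagonal_mul_diagonal, ← diagonal_one]
  congr 1
  funext i
  rw [← Complex.ofReal_mul, ← Real.exp_add, add_neg_cancel, Real.exp_zero, Complex.ofReal_one]

/-- `diag(e^{−w}) · diag(e^{w}) = 1`. -/
theorem diagonal_exp_neg_mul_diagonal_exp (w : ι → ℝ) :
    diagonal (fun i => ((Real.exp (-w i) : ℝ) : ℂ)) * diagonal (fun i => ((Real.exp (w i) : ℝ) : ℂ)) = 1 := by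
  rw [diagonal_mul_diagonal, ← diagonal_one]
  congr 1
  funext i
  rw [← Complex.ofReal_mul, ← Real.exp_add, neg_add_cancel, Real.exp_zero, Complex.ofReal_one]

/-- The nonsingular inverse of `diag(e^w)` is `diag(e^{−w})`. -/
theorem inv_diagonal_exp (w : ι → ℝ) :
    (diagonal (fun i => ((Real.exp (w i) : ℝ) : ℂ)))⁻¹ = diagonal (fun i => ((Real.exp (-w i) : ℝ) : ℂ)) :=
  Matrix.inv_eq_right_inv (diagonal_exp_mul_diagonal_exp_neg w)

/-- `diag(e^w)` is invertible. -/
theorem isUnit_diagonal_exp (w : ι → ℝ) : IsUnit (diagonal (fun i => ((Real.exp (w i) : ℝ) : ℂ))) :=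
  (Matrix.isUnit_iff_isUnit_det _).2
    (Matrix.isUnit_det_of_right_inverse (diagonal_exp_mul_diagonal_exp_neg w))

/-- **Entrywise effect of the conjugation.** If `|w(x) − w(y)| ≤ μ` whenever `M_{xy} ≠ 0`, then
`|(ρ_w M ρ_w⁻¹ − M)_{xy}| ≤ (e^μ − 1)|M_{xy}|`. -/
theorem norm_conj_sub_apply_le (w : ι → ℝ) (M : Matrix ι ι ℂ) {μ : ℝ} (hw : ∀ x y, M x y ≠ 0 → |w x - w y| ≤ μ) (x y : ι) :
    ‖(diagonal (fun i => ((Real.exp (w i) : ℝ) : ℂ)) * M * diagonal (fun i => ((Real.exp (-w i) : ℝ) : ℂ)) - M) x y‖ ≤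
      (Real.exp μ - 1) * ‖M x y‖ := by
  rw [Matrix.sub_apply, diagonal_exp_mul_mul_diagonal_exp_neg_apply]
  by_cases hM : M x y = 0
  · simp [hM]
  have h1 : ((Real.exp (w x - w y) : ℝ) : ℂ) * M x y - M x y = ((Real.exp (w x - w y) - 1 : ℝ) : ℂ) * M x y := by
    push_cast; ring
  rw [h1, norm_mul, Complex.norm_real, Real.norm_eq_abs]
  refine mul_le_mul_of_nonneg_right ?_ (norm_nonneg _)
  calc |Real.exp (w x - w y) - 1| ≤ Real.exp |w x - w y| - 1 :=
        Literature.Geometry.Lorentzian.Deformation.abs_exp_sub_one_le_exp_abs_sub_one _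
    _ ≤ Real.exp μ - 1 := by linarith [Real.exp_le_exp.2 (hw x y hM)]

/-- Row sums of `ρ_w M ρ_w⁻¹ − M` are at most `(e^μ − 1)` times those of `M`. -/
theorem sum_norm_conj_sub_row_le (w : ι → ℝ) (M : Matrix ι ι ℂ) {μ : ℝ} (hw : ∀ x y, M x y ≠ 0 → |w x - w y| ≤ μ) (x : ι) :
    ∑ y, ‖(diagonal (fun i => ((Real.exp (w i) : ℝ) : ℂ)) * M * diagonal (fun i => ((Real.exp (-w i) : ℝ) : ℂ)) - M) x y‖ ≤
      (Real.exp μ - 1) * ∑ y, ‖M x y‖ := by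
  rw [Finset.mul_sum]
  exact Finset.sum_le_sum fun y _ => norm_conj_sub_apply_le w M hw x y

/-! ## §2 The `ℓ∞`-operator Banach algebra: exponential of the conjugate versus the exponential -/

section OpNorm

open scoped Matrix.Norms.Operator

/-- A bound on every absolute row sum bounds the `ℓ∞`-operator norm. -/
theorem linfty_opNorm_le_of_rows (A : Matrix ι ι ℂ) {R : ℝ} (hR : 0 ≤ R) (h : ∀ i, ∑ j, ‖A i j‖ ≤ R) : ‖A‖ ≤ R := by
  rw [Matrix.linfty_opNorm_def]
  have : ((Finset.univ : Finset ι).sup fun i : ι => ∑ j : ι, ‖A i j‖₊) ≤ ⟨R, hR⟩ := by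
    refine Finset.sup_le fun i _ => ?_
    rw [← NNReal.coe_le_coe]
    push_cast
    exact h i
  exact_mod_cast this

/-- Every absolute row sum is bounded by the `ℓ∞`-operator norm. -/
theorem row_le_linfty_opNorm (A : Matrix ι ι ℂ) (i : ι) : ∑ j, ‖A i j‖ ≤ ‖A‖ := by
  rw [Matrix.linfty_opNorm_def]
  have : (∑ j : ι, ‖A i j‖₊) ≤ (Finset.univ : Finset ι).sup fun i : ι => ∑ j : ι, ‖A i j‖₊ :=
    Finset.le_sup (f := fun i : ι => ∑ j : ι, ‖A i j‖₊) (Finset.mem_univ i)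
  have := NNReal.coe_le_coe.2 this
  push_cast at this
  exact this

/-- **Exponential of the conjugate versus the exponential, row-sum form.** If the rows of `M` have absolute sums `≤ m` and
`|w(x) − w(y)| ≤ μ` (`μ ≥ 0`) across every non-zero entry of `M`, then every row of `ρ_w e^{cM} ρ_w⁻¹ − e^{cM}` has absolute sum at
most `‖c‖(e^μ − 1)m · e^{‖c‖ e^μ m}`. -/
theorem sum_norm_conj_exp_sub_exp_row_le (w : ι → ℝ) (M : Matrix ι ι ℂ) (c : ℂ) {μ m : ℝ} (hμ : 0 ≤ μ)
    (hm : ∀ x, ∑ y, ‖M x y‖ ≤ m) (hw : ∀ x y, M x y ≠ 0 → |w x - w y| ≤ μ) (x : ι) :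
    ∑ y, ‖(diagonal (fun i => ((Real.exp (w i) : ℝ) : ℂ)) * exp (c • M) * diagonal (fun i => ((Real.exp (-w i) : ℝ) : ℂ)) -
        exp (c • M)) x y‖ ≤ ‖c‖ * ((Real.exp μ - 1) * m) * Real.exp (‖c‖ * (Real.exp μ * m)) := by
  haveI : Nonempty ι := ⟨x⟩
  have hm0 : 0 ≤ m := le_trans (Finset.sum_nonneg fun y _ => norm_nonneg _) (hm x)
  have heμ : 0 ≤ Real.exp μ - 1 := by linarith [Real.add_one_le_exp μ]
  set ρ : Matrix ι ι ℂ := diagonal (fun i => ((Real.exp (w i) : ℝ) : ℂ)) with hρ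
  set ρ' : Matrix ι ι ℂ := diagonal (fun i => ((Real.exp (-w i) : ℝ) : ℂ)) with hρ'
  have hinv : ρ⁻¹ = ρ' := inv_diagonal_exp w
  -- the conjugate of the exponential is the exponential of the conjugate
  have hconj : ρ * exp (c • M) * ρ' = exp (c • (ρ * M * ρ')) := by
    rw [← hinv, ← Matrix.exp_conj _ _ (isUnit_diagonal_exp w), Matrix.mul_smul, Matrix.smul_mul]
  rw [hconj]
  -- norms in the `ℓ∞`-operator algebra
  have hY : ‖c • M‖ ≤ ‖c‖ * m := by
    rw [norm_smul]
    exact mul_le_mul_of_nonneg_left (linfty_opNorm_le_of_rows M hm0 hm) (norm_nonneg c)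
  have hXY : ‖c • (ρ * M * ρ') - c • M‖ ≤ ‖c‖ * ((Real.exp μ - 1) * m) := by
    rw [← smul_sub, norm_smul]
    refine mul_le_mul_of_nonneg_left (linfty_opNorm_le_of_rows _ (mul_nonneg heμ hm0) fun i => ?_) (norm_nonneg c)
    exact (sum_norm_conj_sub_row_le w M hw i).trans (mul_le_mul_of_nonneg_left (hm i) heμ)
  have hX : ‖c • (ρ * M * ρ')‖ ≤ ‖c‖ * (Real.exp μ * m) := by
    have h1 : c • (ρ * M * ρ') = c • M + (c • (ρ * M * ρ') - c • M) := by abel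
    rw [h1]
    refine (norm_add_le _ _).trans ?_
    calc ‖c • M‖ + ‖c • (ρ * M * ρ') - c • M‖ ≤ ‖c‖ * m + ‖c‖ * ((Real.exp μ - 1) * m) := add_le_add hY hXY
      _ = ‖c‖ * (Real.exp μ * m) := by ring
  have hY' : ‖c • M‖ ≤ ‖c‖ * (Real.exp μ * m) := by
    refine hY.trans (mul_le_mul_of_nonneg_left ?_ (norm_nonneg c))
    have : 1 ≤ Real.exp μ := Real.one_le_exp hμ
    nlinarith
  have hmain := norm_exp_sub_exp_le ℂ (c • (ρ * M * ρ')) (c • M) hX hY'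
  exact (row_le_linfty_opNorm _ x).trans (hmain.trans (mul_le_mul_of_nonneg_right hXY (Real.exp_pos _).le))

end OpNorm

/-- **Column-sum form** (for a symmetric `M`): the columns of `ρ_w e^{cM} ρ_w⁻¹ − e^{cM}` are the rows of the same object for the weight
`−w`, so they obey the same bound. -/
theorem sum_norm_conj_exp_sub_exp_col_le (w : ι → ℝ) (M : Matrix ι ι ℂ) (hMt : Mᵀ = M) (c : ℂ) {μ m : ℝ} (hμ : 0 ≤ μ)
    (hm : ∀ x, ∑ y, ‖M x y‖ ≤ m) (hw : ∀ x y, M x y ≠ 0 → |w x - w y| ≤ μ) (y : ι) :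
    ∑ x, ‖(diagonal (fun i => ((Real.exp (w i) : ℝ) : ℂ)) * exp (c • M) * diagonal (fun i => ((Real.exp (-w i) : ℝ) : ℂ)) -
        exp (c • M)) x y‖ ≤ ‖c‖ * ((Real.exp μ - 1) * m) * Real.exp (‖c‖ * (Real.exp μ * m)) := by
  have hEt : (exp (c • M))ᵀ = exp (c • M) := by rw [← Matrix.exp_transpose, transpose_smul, hMt]
  have hw' : ∀ x y, M x y ≠ 0 → |(-w) x - (-w) y| ≤ μ := by
    intro x y' hxy
    have := hw x y' hxy
    rw [Pi.neg_apply, Pi.neg_apply, show -w x - -w y' = -(w x - w y') by ring, abs_neg]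
    exact this
  have key : ∀ x, (diagonal (fun i => ((Real.exp (w i) : ℝ) : ℂ)) * exp (c • M) * diagonal (fun i => ((Real.exp (-w i) : ℝ) : ℂ)) -
        exp (c • M)) x y =
      (diagonal (fun i => ((Real.exp ((-w) i) : ℝ) : ℂ)) * exp (c • M) * diagonal (fun i => ((Real.exp (-(-w) i) : ℝ) : ℂ)) -
        exp (c • M)) y x := by
    intro x
    rw [Matrix.sub_apply, Matrix.sub_apply, diagonal_exp_mul_mul_diagonal_exp_neg_apply,
      diagonal_exp_mul_mul_diagonal_exp_neg_apply, Pi.neg_apply, Pi.neg_apply]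
    have h1 : (exp (c • M)) y x = (exp (c • M)) x y := by
      rw [← hEt, transpose_apply, hEt]
    rw [h1, show -w y - -w x = w x - w y by ring]
  simp only [key]
  exact sum_norm_conj_exp_sub_exp_row_le (-w) M c hμ hm hw' y

/-! ## §3 Euclidean lower bounds: stability under a quarter-size perturbation, invertibility, entries of the inverse -/

omit [DecidableEq ι] in
/-- `Re⟨ta + b, ta + b⟩ = t²Re⟨a,a⟩ + 2t Re⟨a,b⟩ + Re⟨b,b⟩` for real `t`. -/
theorem re_star_dotProduct_smul_add (a b : ι → ℂ) (t : ℝ) :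
    (star ((t : ℂ) • a + b) ⬝ᵥ ((t : ℂ) • a + b)).re =
      t ^ 2 * (star a ⬝ᵥ a).re + 2 * t * (star a ⬝ᵥ b).re + (star b ⬝ᵥ b).re := by
  have hba : (star b ⬝ᵥ a).re = (star a ⬝ᵥ b).re := by
    rw [star_dotProduct, Complex.star_def, Complex.conj_re]
  rw [star_add, star_smul, add_dotProduct, dotProduct_add, dotProduct_add, smul_dotProduct, smul_dotProduct, dotProduct_smul,
    dotProduct_smul, Complex.star_def, Complex.conj_ofReal]
  simp only [smul_eq_mul, Complex.add_re, Complex.re_ofReal_mul, hba]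
  ring

omit [DecidableEq ι] in
/-- **A lower bound survives a quarter-size perturbation** (square-root-free): if `s²‖v‖² ≤ ‖Av‖²` and `‖Bv‖² ≤ (s²/16)‖v‖²` for all
`v`, then `(s²/4)‖v‖² ≤ ‖(A + B)v‖²`. -/
theorem lowerBound_add_of_small {A B : Matrix ι ι ℂ} {s : ℝ}
    (hA : ∀ v : ι → ℂ, s ^ 2 * (star v ⬝ᵥ v).re ≤ (star (A *ᵥ v) ⬝ᵥ (A *ᵥ v)).re)
    (hB : ∀ v : ι → ℂ, (star (B *ᵥ v) ⬝ᵥ (B *ᵥ v)).re ≤ s ^ 2 / 16 * (star v ⬝ᵥ v).re) (v : ι → ℂ) :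
    s ^ 2 / 4 * (star v ⬝ᵥ v).re ≤ (star ((A + B) *ᵥ v) ⬝ᵥ ((A + B) *ᵥ v)).re := by
  set a : ι → ℂ := A *ᵥ v
  set b : ι → ℂ := B *ᵥ v
  have hsum : (A + B) *ᵥ v = ((1 : ℝ) : ℂ) • a + b := by
    rw [Matrix.add_mulVec, Complex.ofReal_one, one_smul]
  have h0 : 0 ≤ (star ((((1 / 2 : ℝ) : ℂ)) • a + b) ⬝ᵥ ((((1 / 2 : ℝ) : ℂ)) • a + b)).re :=
    (Complex.nonneg_iff.1 (dotProduct_star_self_nonneg _)).1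
  rw [re_star_dotProduct_smul_add] at h0
  rw [hsum, re_star_dotProduct_smul_add]
  have hV : 0 ≤ (star v ⬝ᵥ v).re := (Complex.nonneg_iff.1 (dotProduct_star_self_nonneg v)).1
  nlinarith [hA v, hB v, hV]

/-- A matrix with a positive Euclidean lower bound is invertible. -/
theorem isUnit_of_lowerBound {A : Matrix ι ι ℂ} {c : ℝ} (hc : 0 < c)
    (hlow : ∀ v : ι → ℂ, c * (star v ⬝ᵥ v).re ≤ (star (A *ᵥ v) ⬝ᵥ (A *ᵥ v)).re) : IsUnit A := by
  rw [← Matrix.mulVec_injective_iff_isUnit]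
  intro v w hvw
  have h := hlow (v - w)
  rw [Matrix.mulVec_sub, hvw, sub_self, star_zero, zero_dotProduct, Complex.zero_re] at h
  have hV : 0 ≤ (star (v - w) ⬝ᵥ (v - w)).re := (Complex.nonneg_iff.1 (dotProduct_star_self_nonneg _)).1
  have hzero : (star (v - w) ⬝ᵥ (v - w)).re = 0 := by nlinarith
  have h0 : star (v - w) ⬝ᵥ (v - w) = 0 := by
    rw [eq_ofReal_re_of_nonneg (dotProduct_star_self_nonneg (v - w)), hzero, Complex.ofReal_zero]
  exact sub_eq_zero.1 (dotProduct_star_self_eq_zero.1 h0)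

/-- **Entries of the inverse from a Euclidean lower bound**: `c‖v‖² ≤ ‖Av‖²` for all `v` (`c > 0`) gives `|(A⁻¹)_{ij}|² ≤ 1/c`. -/
theorem norm_inv_apply_sq_le {A : Matrix ι ι ℂ} {c : ℝ} (hc : 0 < c)
    (hlow : ∀ v : ι → ℂ, c * (star v ⬝ᵥ v).re ≤ (star (A *ᵥ v) ⬝ᵥ (A *ᵥ v)).re) (i j : ι) : ‖A⁻¹ i j‖ ^ 2 ≤ 1 / c := by
  have hU : IsUnit A := isUnit_of_lowerBound hc hlow
  have hdet : IsUnit A.det := (Matrix.isUnit_iff_isUnit_det _).1 hU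
  set v : ι → ℂ := A⁻¹ *ᵥ Pi.single j 1 with hv
  have hAv : A *ᵥ v = Pi.single j 1 := by
    rw [hv, Matrix.mulVec_mulVec, Matrix.mul_nonsing_inv _ hdet, Matrix.one_mulVec]
  have he : (star (Pi.single j (1 : ℂ) : ι → ℂ) ⬝ᵥ (Pi.single j 1)).re = 1 := by
    rw [EigenvalueContinuation.re_star_dotProduct_self, Finset.sum_eq_single j]
    · simp
    · intro b _ hb
      simp [hb]
    · intro h
      exact absurd (Finset.mem_univ j) h
  have h1 := hlow v
  rw [hAv, he] at h1
  have hvi : v i = A⁻¹ i j := by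
    rw [hv, Matrix.mulVec_single_one]
    rfl
  have h2 := EigenvalueContinuation.norm_apply_sq_le v i
  rw [hvi] at h2
  rw [le_div_iff₀ hc]
  nlinarith

end Generic

end Summit.Ventures.CertifiedManyBodySolver.Theorems.TcThermcert1.FreeCanonicalB8

end
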